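import Summits.PneNP.PneNP.Theorems.RamseyUncertifiableSosUncertaintyDefs
import Literature.Combinatorics.SimpleGraph.LovaszThetaDual
import Mathlib.Analysis.LocallyConvex.Separation
import Mathlib.Topology.Algebra.Module.FiniteDimension
import Mathlib.Topology.Instances.Matrix
import Mathlib.LinearAlgebra.Pi

/-!
# Route RamseyUncertifiable, crux `SosUncertainty` (stmt-PneNP-9815), line
`hadamard-bessel-defect`: conic strong duality for Laurent's program (22)

The registered stub `stub_strongDuality` of the line: if the weight `w` lies in the antiblocker
of the level-`t` Lasserre body of `G` (`Σ_v w_v y_v ≤ 1` for every level-`t` feasible `y`,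
`Literature.Combinatorics.SimpleGraph.IsLasserreFeasible`), then for every `ε > 0` the shrunk
weight `w/(1+ε)` admits a level-`t` SoS certificate (`IsCertificate` of
`RamseyUncertifiableSosUncertaintyDefs.lean`): semidefinite strong duality for program (22) in
`ε`-form (no attainment, no Slater point, no closedness of the image of the PSD cone needed).

Proof — the separation argument of `Literature/Combinatorics/SimpleGraph/LovaszThetaDual.lean`
(`exists_dual_of_lovaszTheta_lt`) transplanted. Work with matrices `P` indexed by the STABLE
level-`t` indices `SIdx G t` and the linear constraint map `cmap` recording, at every stable `U`,
the union sum `pairSum P U = Σ_{I ∪ J = U} P_{IJ}`; the target vector is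
`b = (1+ε) e_∅ − Σ_v w_v e_{v}`.
* If some `P ⪰ 0` has `cmap P = b`, its zero-extension `zeroExt P` to `P_t(V)`, divided by
  `1+ε`, is the certificate (`unionSum (zeroExt P) = pairSum P`, `posSemidef_of_block`).
* Otherwise the compact convex image of the spectraplex `{P ⪰ 0, Tr P = 1}`
  (`isCompact_setOf_isSpectraplex`) misses the closed ray `ℝ₊ b` (a PSD `P` all of whose stable
  union sums vanish is zero, `eq_zero_of_pairSum_eq_zero`), and Mathlib's geometric Hahn–Banach
  (`geometric_hahn_banach_compact_closed`) gives a functional `f < 0` on the image with `f b ≥ 0`.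
  Its coordinates, sign-flipped and cut off at the non-stable sets, form a sequence `z` whose
  stable moment block is positive definite; `z / z_∅` is level-`t` feasible with
  `Σ_v w_v z_v / z_∅ ≥ 1 + ε > 1`, contradicting the hypothesis.

Conic duality is standard (Laurent 2006 §3.1 for the program); no single source. [folklore]
-/

noncomputable section

open scoped BigOperators Matrix Classical

namespace Summit.PneNP.PneNP.Cruxes.SosUncertainty.HadamardBesselDefect

open Finset Matrix Literature.Combinatorics.SimpleGraph

set_option linter.dupNamespace false -- `Summit.PneNP.PneNP.…`: summit = sub-problem name (D-0017)

/-! ### Sums supported on a subtype; zero-extension of positive semidefinite matrices -/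

section ZeroExtension

variable {ι : Type*} [Fintype ι] {p : ι → Prop} [DecidablePred p]

/-- A finite sum whose terms vanish off `p` is the sum over the subtype `{i // p i}`.
[folklore] -/
theorem sum_eq_sum_subtype_of_eq_zero {F : ι → ℝ} (hF : ∀ i, ¬p i → F i = 0) :
    ∑ i, F i = ∑ i : {i // p i}, F i.1 := by
  rw [← Finset.sum_filter_of_ne (s := Finset.univ) (p := p)
    fun i _ hi => not_imp_comm.1 (hF i) hi]
  exact Finset.sum_subtype _ (fun i => by simp) F

/-- A real matrix vanishing outside the block `{i // p i} × {i // p i}` whose block is positive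
semidefinite is positive semidefinite (zero-extension preserves `⪰ 0`). [folklore] -/
theorem posSemidef_of_block {M : Matrix ι ι ℝ} (hrow : ∀ i j, ¬p i → M i j = 0)
    (hcol : ∀ i j, ¬p j → M i j = 0)
    (hM : (M.submatrix (Subtype.val : {i // p i} → ι) Subtype.val).PosSemidef) :
    M.PosSemidef := by
  refine PosSemidef.of_dotProduct_mulVec_nonneg (Matrix.IsHermitian.ext fun i j => ?_) fun x => ?_
  · rw [star_trivial]
    by_cases hi : p i
    · by_cases hj : p j
      · have h := hM.isHermitian.apply ⟨i, hi⟩ ⟨j, hj⟩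
        rwa [star_trivial] at h
      · rw [hrow j i hj, hcol i j hj]
    · rw [hcol j i hi, hrow i j hi]
  · have hx : x ⬝ᵥ (M *ᵥ x) = (fun i : {i // p i} => x i.1) ⬝ᵥ
        ((M.submatrix Subtype.val Subtype.val) *ᵥ fun i : {i // p i} => x i.1) := by
      rw [dotProduct_mulVec_eq_sum_mul, dotProduct_mulVec_eq_sum_mul,
        sum_eq_sum_subtype_of_eq_zero (p := p) fun i hi =>
          Finset.sum_eq_zero fun j _ => by rw [hrow i j hi, zero_mul]]
      refine Finset.sum_congr rfl fun i _ => ?_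
      rw [sum_eq_sum_subtype_of_eq_zero (p := p) fun j hj => by rw [hcol i.1 j hj, zero_mul]]
      rfl
    have h := hM.dotProduct_mulVec_nonneg fun i : {i // p i} => x i.1
    rw [star_trivial] at h ⊢
    rwa [hx]

end ZeroExtension

/-! ### Stable indices, union sums on the stable block, the constraint map -/

variable {V : Type*} [Fintype V] [DecidableEq V]

/-- The STABLE level-`t` indices `{S ∈ P_t(V) : S stable in G}` — the support of the
certificates constructed here. [folklore] -/
abbrev SIdx (G : SimpleGraph V) (t : ℕ) : Type _ := {I : Idx V t // G.IsIndepSet (I.1 : Set V)}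

variable {G : SimpleGraph V} {t : ℕ}

/-- Union sums on the stable block: `pairSum P U = Σ_{I ∪ J = U} P_{IJ}` over stable level-`t`
indices `I, J`. [folklore] -/
def pairSum (P : Matrix (SIdx G t) (SIdx G t) ℝ) (U : Finset V) : ℝ :=
  ∑ I : SIdx G t, ∑ J : SIdx G t, if I.1.1 ∪ J.1.1 = U then P I J else 0

/-- Regrouping by the union: `Σ_U pairSum P U · g U = Σ_{I,J} P_{IJ} g(I ∪ J)`. [folklore] -/
theorem sum_pairSum_mul (P : Matrix (SIdx G t) (SIdx G t) ℝ) (g : Finset V → ℝ) :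
    ∑ U, pairSum P U * g U = ∑ I : SIdx G t, ∑ J : SIdx G t, P I J * g (I.1.1 ∪ J.1.1) := by
  simp only [pairSum, Finset.sum_mul, ite_mul, zero_mul]
  rw [Finset.sum_comm]
  refine Finset.sum_congr rfl fun I _ => ?_
  rw [Finset.sum_comm]
  refine Finset.sum_congr rfl fun J _ => ?_
  rw [Finset.sum_ite_eq]
  exact if_pos (Finset.mem_univ _)

/-- **Kernel lemma**: a positive semidefinite matrix on the stable block all of whose stable
union sums vanish is zero. Induction on `|I|`: the union sum at `U = I` is `P_{II}` plus entries
in rows or columns of diagonal indices `J ⊊ I`, which vanish inductively (a zero diagonal entry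
kills its row and column, `psd_apply_eq_zero_of_diag_eq_zero`). [folklore] -/
theorem eq_zero_of_pairSum_eq_zero {P : Matrix (SIdx G t) (SIdx G t) ℝ} (hP : P.PosSemidef)
    (h0 : ∀ I : SIdx G t, pairSum P I.1.1 = 0) : P = 0 := by
  have hsymm : ∀ I J, P J I = P I J := fun I J => by
    simpa only [star_trivial] using hP.isHermitian.apply I J
  -- diagonal entries vanish, by strong induction on the cardinality of the index
  have hdiag : ∀ (k : ℕ) (I : SIdx G t), I.1.1.card = k → P I I = 0 := by
    intro k
    induction k using Nat.strong_induction_on with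
    | _ k ih =>
      intro I hI
      have hoff : ∀ J K : SIdx G t, J.1.1 ∪ K.1.1 = I.1.1 → J ≠ I →
          P J K = 0 ∧ P K J = 0 := fun J K hJK hJ => by
        have hsub : J.1.1 ⊆ I.1.1 := hJK ▸ Finset.subset_union_left
        have hne : J.1.1 ≠ I.1.1 := fun h => hJ (Subtype.ext (Subtype.ext h))
        have hlt : J.1.1.card < k :=
          hI ▸ Finset.card_lt_card (Finset.ssubset_iff_subset_ne.2 ⟨hsub, hne⟩)
        have hKJ : P K J = 0 := psd_apply_eq_zero_of_diag_eq_zero hP (ih _ hlt J rfl) K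
        exact ⟨(hsymm J K).symm.trans hKJ, hKJ⟩
      have key : pairSum P I.1.1 = P I I := by
        unfold pairSum
        rw [Finset.sum_eq_single_of_mem I (Finset.mem_univ _) fun J _ hJ =>
          Finset.sum_eq_zero fun K _ => ite_eq_right_iff.2 fun hJK => (hoff J K hJK hJ).1]
        rw [Finset.sum_eq_single_of_mem I (Finset.mem_univ _) fun K _ hK =>
          ite_eq_right_iff.2 fun hIK => (hoff K I ((Finset.union_comm _ _).trans hIK) hK).2]
        exact if_pos (Finset.union_self _)
      exact key ▸ h0 I
  ext I J
  exact psd_apply_eq_zero_of_diag_eq_zero hP (hdiag _ J rfl) I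

variable (G t) in
/-- The constraint map of the conic program: `P ↦ (U ↦ [U stable] · Σ_{I ∪ J = U} P_{IJ})`,
a linear map from matrices on the stable block to sequences on all subsets. [folklore] -/
def cmap : Matrix (SIdx G t) (SIdx G t) ℝ →ₗ[ℝ] (Finset V → ℝ) where
  toFun P U := if G.IsIndepSet (U : Set V) then pairSum P U else 0
  map_add' P R := by
    funext U
    have h : pairSum (P + R) U = pairSum P U + pairSum R U := by
      simp only [pairSum, ← Finset.sum_add_distrib]
      refine Finset.sum_congr rfl fun I _ => Finset.sum_congr rfl fun J _ => ?_
      split_ifs <;> simp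
    simp only [Pi.add_apply]
    split_ifs <;> simp [h]
  map_smul' c P := by
    funext U
    have h : pairSum (c • P) U = c * pairSum P U := by
      simp only [pairSum, Finset.mul_sum]
      refine Finset.sum_congr rfl fun I _ => Finset.sum_congr rfl fun J _ => ?_
      split_ifs <;> simp
    simp only [Pi.smul_apply, RingHom.id_apply, smul_eq_mul]
    split_ifs <;> simp [h]

/-- Coordinates of the constraint map. [folklore] -/
theorem cmap_apply (P : Matrix (SIdx G t) (SIdx G t) ℝ) (U : Finset V) :
    cmap G t P U = if G.IsIndepSet (U : Set V) then pairSum P U else 0 := rfl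

/-- The constraint map is continuous (finite sums of coordinate projections). [folklore] -/
theorem continuous_cmap : Continuous (cmap G t) := by
  refine continuous_pi fun U => ?_
  by_cases hU : G.IsIndepSet (U : Set V)
  · simp only [cmap_apply, if_pos hU, pairSum]
    refine continuous_finsetSum _ fun I _ => continuous_finsetSum _ fun J _ => ?_
    by_cases hIJ : I.1.1 ∪ J.1.1 = U
    · simp only [if_pos hIJ]
      exact continuous_id.matrix_elem I J
    · simp only [if_neg hIJ]
      exact continuous_const
  · simp only [cmap_apply, if_neg hU]
    exact continuous_const

/-- Zero-extension of a matrix on the stable block to all of `P_t(V)`. [folklore] -/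
def zeroExt (P : Matrix (SIdx G t) (SIdx G t) ℝ) : Matrix (Idx V t) (Idx V t) ℝ :=
  fun I J => if h : G.IsIndepSet (I.1 : Set V) ∧ G.IsIndepSet (J.1 : Set V) then
    P ⟨I, h.1⟩ ⟨J, h.2⟩ else 0

/-- Zero-extension preserves positive semidefiniteness. [folklore] -/
theorem posSemidef_zeroExt {P : Matrix (SIdx G t) (SIdx G t) ℝ} (hP : P.PosSemidef) :
    (zeroExt P).PosSemidef := by
  refine posSemidef_of_block (p := fun I : Idx V t => G.IsIndepSet (I.1 : Set V))
    (fun I J hI => dif_neg fun h => hI h.1) (fun I J hJ => dif_neg fun h => hJ h.2) ?_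
  have h : (zeroExt P).submatrix Subtype.val Subtype.val = P := by
    ext I J
    simp [zeroExt, I.2, J.2]
  rwa [h]

/-- The union sums of the zero-extension are the stable-block union sums. [folklore] -/
theorem unionSum_zeroExt (P : Matrix (SIdx G t) (SIdx G t) ℝ) (U : Finset V) :
    unionSum (zeroExt P) U = pairSum P U := by
  unfold unionSum pairSum
  rw [sum_eq_sum_subtype_of_eq_zero (p := fun I : Idx V t => G.IsIndepSet (I.1 : Set V))
    fun I hI => Finset.sum_eq_zero fun J _ => by simp [zeroExt, hI]]
  refine Finset.sum_congr rfl fun I _ => ?_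
  rw [sum_eq_sum_subtype_of_eq_zero (p := fun J : Idx V t => G.IsIndepSet (J.1 : Set V))
    fun J hJ => by simp [zeroExt, hJ]]
  exact Finset.sum_congr rfl fun J _ => by simp [zeroExt, I.2, J.2]

/-- Union sums are linear: `unionSum (c • Q) U = c · unionSum Q U`. [folklore] -/
theorem unionSum_smul (c : ℝ) (Q : Matrix (Idx V t) (Idx V t) ℝ) (U : Finset V) :
    unionSum (c • Q) U = c * unionSum Q U := by
  simp only [unionSum, Finset.mul_sum, Matrix.smul_apply, smul_eq_mul]
  refine Finset.sum_congr rfl fun I _ => Finset.sum_congr rfl fun J _ => ?_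
  split_ifs <;> simp

/-! ### Strong duality -/

/-- **Conic strong duality for Laurent's program (22), `ε`-form** (registered stub
`stub_strongDuality` of the line `hadamard-bessel-defect`): if `Σ_v w_v y_v ≤ 1` for every
level-`t` feasible `y` of `G`, then for every `ε > 0` the weight `w/(1+ε)` has a level-`t` SoS
certificate. Proof by separating the closed ray `ℝ₊ b`, `b = (1+ε)e_∅ − Σ_v w_v e_{v}`, from
the compact convex image of the spectraplex of stable-indexed PSD matrices under the constraint
map (`geometric_hahn_banach_compact_closed`); see the module docstring. [folklore] -/
theorem stub_strongDuality :
    ∀ (n t : ℕ), 1 ≤ t → ∀ (G : SimpleGraph (Fin n)) (w : Fin n → ℝ),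
      (∀ y : Finset (Fin n) → ℝ, IsLasserreFeasible G t y → ∑ v, w v * y {v} ≤ 1) →
        ∀ ε : ℝ, 0 < ε → ∃ Q : Matrix (Idx (Fin n) t) (Idx (Fin n) t) ℝ,
          IsCertificate G t (fun v => w v / (1 + ε)) Q := by
  intro n t _ht G w hw ε hε
  have hε1 : (0 : ℝ) < 1 + ε := by linarith
  -- coordinate vectors, the target vector `b` and its coordinates at stable sets
  set e : Finset (Fin n) → Finset (Fin n) → ℝ := fun U U' => if U = U' then 1 else 0 with he
  set b : Finset (Fin n) → ℝ := (1 + ε) • e ∅ - ∑ v, w v • e {v} with hb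
  have hb0 : b ∅ = 1 + ε := by simp [hb, he, Finset.sum_apply]
  have hb1 : ∀ v, b {v} = -w v := fun v => by
    simp [hb, he, Finset.sum_apply, Finset.empty_ne_singleton, Finset.singleton_inj]
  have hb2 : ∀ U : Finset (Fin n), 2 ≤ U.card → b U = 0 := fun U hU => by
    have hU0 : (∅ : Finset (Fin n)) ≠ U := fun h => by simp [← h] at hU
    have hU1 : ∀ v : Fin n, ({v} : Finset (Fin n)) ≠ U := fun v h => by simp [← h] at hU
    simp [hb, he, Finset.sum_apply, hU0, hU1]
  have hst0 : G.IsIndepSet ((∅ : Finset (Fin n)) : Set (Fin n)) := by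
    simp [SimpleGraph.isIndepSet_iff]
  have hst1 : ∀ v : Fin n, G.IsIndepSet (({v} : Finset (Fin n)) : Set (Fin n)) := fun v => by
    simp [SimpleGraph.isIndepSet_iff]
  by_cases hex : ∃ P : Matrix (SIdx G t) (SIdx G t) ℝ, P.PosSemidef ∧ cmap G t P = b
  · -- (i) `b` is attained on the PSD cone: zero-extend and rescale
    obtain ⟨P, hP, hPb⟩ := hex
    have hU : ∀ U : Finset (Fin n), G.IsIndepSet (U : Set (Fin n)) →
        unionSum (zeroExt P) U = b U := fun U hU => by
      rw [unionSum_zeroExt, ← hPb, cmap_apply, if_pos hU]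
    refine ⟨(1 + ε)⁻¹ • zeroExt P, (posSemidef_zeroExt hP).smul (inv_nonneg.2 hε1.le), ?_,
      fun v => ?_, fun U hU2 hUst => ?_⟩
    · rw [unionSum_smul, hU ∅ hst0, hb0, inv_mul_cancel₀ hε1.ne']
    · rw [unionSum_smul, hU {v} (hst1 v), hb1]
      field_simp
    · rw [unionSum_smul, hU U hUst, hb2 U hU2, mul_zero]
  · -- (ii) otherwise: separate the ray `ℝ₊ b` from the image of the spectraplex
    exfalso
    set S : Set (Finset (Fin n) → ℝ) := cmap G t '' {P | IsSpectraplex P} with hS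
    set R : Set (Finset (Fin n) → ℝ) := (fun c : ℝ => c • b) '' Set.Ici 0 with hR
    have hSconv : Convex ℝ S := by
      refine Convex.linear_image (fun P₁ hP₁ P₂ hP₂ a c ha hc hac => ?_) _
      rw [show a = 1 - c by linarith]
      exact IsSpectraplex.convexComb hP₁ hP₂ hc (by linarith)
    have hScomp : IsCompact S := isCompact_setOf_isSpectraplex.image continuous_cmap
    have hRconv : Convex ℝ R := (convex_Ici 0).is_linear_image (IsLinearMap.isLinearMap_smul' b)
    have hRclosed : IsClosed R := isClosedMap_smul_left (𝕜 := ℝ) b _ isClosed_Ici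
    have hdisj : Disjoint S R := by
      rw [Set.disjoint_left]
      rintro _ ⟨P, hP, rfl⟩ ⟨c, hc, hcP⟩
      have hcP' : c • b = cmap G t P := hcP
      rw [Set.mem_Ici] at hc
      rcases hc.eq_or_lt with hc0 | hcpos
      · -- `cmap P = 0`: all stable union sums vanish, so `P = 0`, contradicting `Tr P = 1`
        have h0 : cmap G t P = 0 := by rw [← hcP', ← hc0, zero_smul]
        have hP0 : P = 0 := eq_zero_of_pairSum_eq_zero hP.posSemidef fun I => by
          have h := congrFun h0 I.1.1
          rwa [cmap_apply, if_pos I.2] at h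
        have h1 := hP.trace_eq_one
        rw [hP0, Matrix.trace_zero] at h1
        exact zero_ne_one h1
      · refine hex ⟨c⁻¹ • P, hP.posSemidef.smul (inv_nonneg.2 hcpos.le), ?_⟩
        rw [map_smul, ← hcP', smul_smul, inv_mul_cancel₀ hcpos.ne', one_smul]
    obtain ⟨f, u, v, hfS, huv, hfR⟩ :=
      geometric_hahn_banach_compact_closed hSconv hScomp hRconv hRclosed hdisj
    have hv0 : v < 0 := by simpa using hfR 0 ⟨0, Set.mem_Ici.2 le_rfl, zero_smul _ _⟩
    have hfb : 0 ≤ f b := by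
      by_contra hneg
      rw [not_le] at hneg
      have h := hfR _ ⟨v / f b, Set.mem_Ici.2 (div_pos_of_neg_of_neg hv0 hneg).le, rfl⟩
      simp only [map_smul, smul_eq_mul] at h
      rw [div_mul_cancel₀ v hneg.ne] at h
      exact lt_irrefl _ h
    have hfneg : ∀ P : Matrix (SIdx G t) (SIdx G t) ℝ, IsSpectraplex P → f (cmap G t P) < 0 :=
      fun P hP => by linarith [hfS _ ⟨P, hP, rfl⟩]
    -- coordinates of `f`, and the sign-flipped stable part `z`
    set yf : Finset (Fin n) → ℝ := fun U => f (e U) with hyf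
    have hfx : ∀ x : Finset (Fin n) → ℝ, f x = ∑ U, x U * yf U := fun x => by
      have h := LinearMap.pi_apply_eq_sum_univ (f : (Finset (Fin n) → ℝ) →ₗ[ℝ] ℝ) x
      simpa only [ContinuousLinearMap.coe_coe, smul_eq_mul] using h
    set z : Finset (Fin n) → ℝ := fun U => if G.IsIndepSet (U : Set (Fin n)) then -yf U else 0
      with hz
    have hzns : ∀ U : Finset (Fin n), ¬G.IsIndepSet (U : Set (Fin n)) → z U = 0 :=
      fun U hU => by simp [hz, hU]
    have hquad : ∀ P : Matrix (SIdx G t) (SIdx G t) ℝ,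
        f (cmap G t P) = -∑ I : SIdx G t, ∑ J : SIdx G t, P I J * z (I.1.1 ∪ J.1.1) := by
      intro P
      rw [hfx, ← sum_pairSum_mul, ← Finset.sum_neg_distrib]
      refine Finset.sum_congr rfl fun U _ => ?_
      rw [cmap_apply]
      simp only [hz]
      split_ifs <;> ring
    have hpos : ∀ P : Matrix (SIdx G t) (SIdx G t) ℝ, IsSpectraplex P →
        0 < ∑ I : SIdx G t, ∑ J : SIdx G t, P I J * z (I.1.1 ∪ J.1.1) := fun P hP => by
      linarith [hquad P ▸ hfneg P hP]
    -- the stable moment block of `z` is positive definite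
    set Ms : Matrix (SIdx G t) (SIdx G t) ℝ := Matrix.of fun I J => z (I.1.1 ∪ J.1.1) with hMs
    have hMs_pos : ∀ x : SIdx G t → ℝ, x ≠ 0 → 0 < x ⬝ᵥ (Ms *ᵥ x) := by
      intro x hx
      have hxx : 0 < x ⬝ᵥ x := lt_of_le_of_ne (dotProduct_self_star_nonneg x)
        fun h => hx (dotProduct_self_eq_zero.1 h.symm)
      have hP₀ : (vecMulVec x x).PosSemidef := by
        have h := posSemidef_vecMulVec_self_star (R := ℝ) x
        rwa [star_trivial] at h
      have htr : (vecMulVec x x).trace = x ⬝ᵥ x := trace_vecMulVec x x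
      have h := hpos _ (IsSpectraplex.of_posSemidef_div hP₀ (by rw [htr]; exact hxx))
      have hsum : ∑ I : SIdx G t, ∑ J : SIdx G t,
          ((vecMulVec x x).trace⁻¹ • vecMulVec x x) I J * z (I.1.1 ∪ J.1.1)
            = (x ⬝ᵥ x)⁻¹ * (x ⬝ᵥ (Ms *ᵥ x)) := by
        rw [htr, dotProduct_mulVec_eq_sum_mul, Finset.mul_sum]
        refine Finset.sum_congr rfl fun I _ => ?_
        rw [Finset.mul_sum]
        refine Finset.sum_congr rfl fun J _ => ?_
        simp only [Matrix.smul_apply, vecMulVec_apply, smul_eq_mul, hMs, Matrix.of_apply]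
        ring
      rw [hsum] at h
      exact (mul_pos_iff_of_pos_left (inv_pos.2 hxx)).1 h
    have hMs_psd : Ms.PosSemidef := by
      refine PosSemidef.of_dotProduct_mulVec_nonneg (Matrix.IsHermitian.ext fun I J => by
        simp only [hMs, Matrix.of_apply, star_trivial, Finset.union_comm]) fun x => ?_
      rw [star_trivial]
      by_cases hx : x = 0
      · rw [hx, Matrix.mulVec_zero, dotProduct_zero]
      · exact (hMs_pos x hx).le
    -- `z ∅ > 0`
    set I0 : SIdx G t := ⟨⟨∅, by simp⟩, hst0⟩ with hI0
    have hz0 : 0 < z ∅ := by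
      have hx : (Pi.single I0 (1 : ℝ) : SIdx G t → ℝ) ≠ 0 := fun h => by
        have h1 := congrFun h I0
        simp at h1
      have h := hMs_pos _ hx
      rw [single_dotProduct_mulVec_single, one_mul, mul_one] at h
      change 0 < z (∅ ∪ ∅) at h
      rwa [Finset.union_self] at h
    -- the moment matrix of `z` is PSD (zero-extension of its stable block): `z/z_∅` is feasible
    have hMz : (momentMatrix t z).PosSemidef := by
      refine posSemidef_of_block (p := fun I : Idx (Fin n) t => G.IsIndepSet (I.1 : Set (Fin n)))
        (fun I J hI => ?_) (fun I J hJ => ?_) ?_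
      · exact hzns (I.1 ∪ J.1) fun h => hI (Set.Pairwise.mono (by simp) h)
      · exact hzns (I.1 ∪ J.1) fun h => hJ (Set.Pairwise.mono (by simp) h)
      · rw [show (momentMatrix t z).submatrix Subtype.val Subtype.val = Ms from
          Matrix.ext fun I J => rfl]
        exact hMs_psd
    have hfeas : IsLasserreFeasible G t fun U => (z ∅)⁻¹ * z U := by
      refine ⟨inv_mul_cancel₀ hz0.ne', fun u v huv => ?_, ?_⟩
      · show (z ∅)⁻¹ * z {u, v} = 0
        rw [hzns {u, v} fun h => h (by simp) (by simp) huv.ne huv, mul_zero]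
      · have hm : momentMatrix t (fun U => (z ∅)⁻¹ * z U) = (z ∅)⁻¹ • momentMatrix t z :=
          Matrix.ext fun I J => by simp [momentMatrix_apply, Matrix.smul_apply]
        rw [hm]
        exact hMz.smul (inv_nonneg.2 hz0.le)
    -- the value: `Σ_v w_v z_v ≤ z_∅` by hypothesis, but `≥ (1+ε) z_∅` from `f b ≥ 0`
    have hval := hw _ hfeas
    have hsum_le : ∑ v, w v * z {v} ≤ z ∅ := by
      have h1 : ∑ v, w v * ((z ∅)⁻¹ * z {v}) = (z ∅)⁻¹ * ∑ v, w v * z {v} := by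
        rw [Finset.mul_sum]
        exact Finset.sum_congr rfl fun v _ => by ring
      rwa [h1, inv_mul_le_iff₀ hz0, mul_one] at hval
    have hy0 : yf ∅ = -z ∅ := by simp [hz]
    have hyv : ∀ v, yf {v} = -z {v} := fun v => by simp [hz]
    have hfb' : f b = (1 + ε) * yf ∅ - ∑ v, w v * yf {v} := by
      simp only [hb, map_sub, map_smul, map_sum, smul_eq_mul, hyf]
    rw [hfb', hy0] at hfb
    simp only [hyv, mul_neg, Finset.sum_neg_distrib, sub_neg_eq_add] at hfb
    nlinarith [mul_pos hε hz0]

end Summit.PneNP.PneNP.Cruxes.SosUncertainty.HadamardBesselDefect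

end
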